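import Literature.MathematicalPhysics.QuantumLattice.WilsonBlockHeatBathSemigroup2

/-!
# Crux `LatticeGapInUVUnits`, line `knabe-block-sampler`: stub S4 `stub_gapToClustering`

Support file for item stmt-QuantumFields-9366 (route `LangevinControlUV` of `YangMills`), registered stub
`stub_gapToClustering` = `SemigroupContraction → LightCone → GapToClustering`: a global block-sampler Poincaré constant
`γ` on the torus `(2S+1)⁴` with nominal cell `b` gives `|corr(A, B, n)| ≤ C(A,B) e^{−ρ n/b}` with `ρ = ρ(γ) > 0`
(Martinelli 1999 §3: block dynamics, finite speed of propagation).  The semigroup contraction and the light cone enter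
as (abstract, Mathlib-only) hypotheses; the heat-bath infrastructure (Haar averaging and gauge-invariant conditional
expectations, Markov locality, the mean-zero invariant sector, the local subspaces, the index geometry) is the
Literature toolkit `WilsonBlockHeatBathSemigroup{,2}`, `WilsonBlockHeatBathLightCone{,2}`.  No definition is introduced.

Main estimate `GapToClustering.abs_latticeConnectedCorr_le_of_globalPoincare` (regime `n ≥ b(2M+11)`): exact
pull-out `⟨f g⟩ = ⟨P_t^{Λ_f} f, P_t^{Λ_g} g⟩` by self-adjointness and locality of the block semigroups, Cauchy–Schwarz,
light cone + contraction with `t = (D+1)/(625 e²)`, `D ≍ n/(4b)`; the stub absorbs small `n/b` with the a priori bound.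
-/

open scoped BigOperators InnerProductSpace
open MeasureTheory Filter Topology
open Literature.MathematicalPhysics.QuantumFieldTheory Literature.MathematicalPhysics.QuantumLattice
open Literature.MathematicalPhysics.QuantumLattice.WilsonBlockHeatBath
open Literature.Analysis.OperatorTheory.KnabeDevice (cdist)

noncomputable section

namespace Summit.QuantumFields.YangMills.Theorems.LatticeGapInUVUnits.KnabeBlockSampler

namespace GapToClustering

/-! ## Part I: the clustering estimate in the main regime -/
section MainEstimate

variable {G : Type} [Group G] [TopologicalSpace G] [IsTopologicalGroup G] [CompactSpace G]
  [MeasurableSpace G] [BorelSpace G] [SecondCountableTopology G] [T2Space G] {Nρ : ℕ}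

set_option maxHeartbeats 800000 in
/-- **Gap ⇒ clustering, main regime** (`n ≥ b(2M+11)`): the finite-speed-of-propagation argument
for the block heat-bath semigroup, given the abstract semigroup contraction and light cone. -/
theorem abs_latticeConnectedCorr_le_of_globalPoincare
    (hSC : ∀ (E : Type) [NormedAddCommGroup E] [InnerProductSpace ℝ E] [CompleteSpace E]
      (H : E →L[ℝ] E) (W : Submodule ℝ E) (γ : ℝ), IsSelfAdjoint H → IsClosed (W : Set E) →
      (∀ x ∈ W, H x ∈ W) → (∀ x ∈ W, γ * ‖x‖ ^ 2 ≤ ⟪H x, x⟫_ℝ) → ∀ (t : ℝ), 0 ≤ t → ∀ x ∈ W,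
      ‖NormedSpace.exp (-(t • H)) x‖ ≤ Real.exp (-(γ * t)) * ‖x‖)
    (hLC : ∀ (E : Type) [NormedAddCommGroup E] [NormedSpace ℝ E] [CompleteSpace E] (ι : Type)
      [Fintype ι] [DecidableEq ι] (adj : ι → ι → Prop) [DecidableRel adj] (K : ℕ) (T : ι → E →L[ℝ] E)
      (M : Finset ι → Submodule ℝ E), (∀ z, adj z z) →
      (∀ w, (Finset.univ.filter fun z => adj z w).card ≤ K) → (∀ z, ‖T z‖ ≤ 1) →
      (∀ R R' : Finset ι, R ⊆ R' → M R ≤ M R') →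
      (∀ (z : ι) (R : Finset ι), ∀ x ∈ M R, T z x ∈ M (insert z R)) →
      (∀ (z : ι) (R : Finset ι), (∀ w ∈ R, ¬ adj z w) → ∀ x ∈ M R, T z x = x) →
      ∀ (R₀ Λ : Finset ι) (D : ℕ) (f : E), f ∈ M R₀ →
      (fun R : Finset ι => Finset.univ.filter fun z => ∃ w ∈ R, adj z w)^[D] R₀ ⊆ Λ →
      ∀ t : ℝ, 0 ≤ t → ‖NormedSpace.exp (-(t • ∑ z : ι, (1 - T z))) f -
        NormedSpace.exp (-(t • ∑ z ∈ Λ, (1 - T z))) f‖ ≤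
        2 * ‖f‖ * R₀.card * (K * t) ^ (D + 1) / (D + 1).factorial)
    (ρ : G →* Matrix (Fin Nρ) (Fin Nρ) ℂ) (hρ : Continuous ρ) {γ : ℝ} (hγ : 0 < γ)
    (A B : YMSpecies G) {CA CB : ℝ} (hCA : ∀ U, |A.F U| ≤ CA) (hCB : ∀ U, |B.F U| ≤ CB)
    (M : ℕ) (hMA : ∀ e ∈ A.supp, (e.1 0).natAbs ≤ M) (hMB : ∀ e ∈ B.supp, (e.1 0).natAbs ≤ M)
    (β : ℝ) {b S n N : ℕ} [NeZero N] (hN : N = 2 * S + 1) (hb : 1 ≤ b) (hnS : n ≤ S)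
    (hn : b * (2 * M + 11) ≤ n) (hGP : GlobalPoincare ρ β N b γ) :
    |latticeConnectedCorr ρ β N A.F B.F n| ≤
      (2 * CA * (81 * A.supp.card + 1)) * (2 * CB * (81 * B.supp.card + 1)) *
        Real.exp (min 1 (γ / (625 * Real.exp 2)) * (M + 4)) *
        Real.exp (-(min 1 (γ / (625 * Real.exp 2)) / 2 * n / b)) := by
  have hNpos : 0 < N := by omega
  have hbpos : 0 < b := hb
  have hMn : M ≤ n := by
    have : M ≤ b * (2 * M + 11) := le_trans (by omega) (Nat.le_mul_of_pos_left _ hbpos)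
    exact this.trans hn
  have hm22 : 2 * (2 * M + 11) ≤ N / b := by
    rw [Nat.le_div_iff_mul_le hbpos]
    have : 2 * (b * (2 * M + 11)) + 1 ≤ N := by omega
    calc 2 * (2 * M + 11) * b = 2 * (b * (2 * M + 11)) := by ring
      _ ≤ N := by omega
  set m := N / b with hmdef
  have hm4 : 4 < m := by omega
  have hm2 : 2 < m := by omega
  have hm0 : 0 < m := by omega
  have hmN : m ≤ N := Nat.div_le_self N b
  have hMN : M < N := by omega
  haveI : NeZero m := ⟨by omega⟩
  set ρ₀ : ℝ := min 1 (γ / (625 * Real.exp 2)) with hρ₀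
  have hρ₀pos : 0 < ρ₀ := lt_min one_pos (by positivity)
  have hCA0 : 0 ≤ CA := (abs_nonneg _).trans (hCA fun _ => 1)
  have hCB0 : 0 ≤ CB := (abs_nonneg _).trans (hCB fun _ => 1)
  set μ : Measure (GaugeConfig 4 N G) := wilsonMeasure (d := 4) (L := N) ρ β with hμ
  haveI : IsProbabilityMeasure μ := isProbabilityMeasure_wilsonMeasure (d := 4) (L := N) ρ hρ β
  haveI hfact : ∀ S' : Set (Edge 4 N), Fact (linkSigma (G := G) S' ≤
      (MeasurableSpace.pi : MeasurableSpace (GaugeConfig 4 N G))) := fun S' => ⟨linkSigma_le S'⟩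
  obtain ⟨hfm, -, hfi, hfdep⟩ := shiftedObservable_props A ((0 : ℕ) : ℤ) N
  obtain ⟨hgm, -, hgi, hgdep⟩ := shiftedObservable_props B ((n : ℕ) : ℤ) N
  set fA : GaugeConfig 4 N G → ℝ := fun U => A.F (configShift (-Pi.single 0 ((0 : ℕ) : ℤ)) (torusLift N U))
    with hfA
  set gB : GaugeConfig 4 N G → ℝ := fun U => B.F (configShift (-Pi.single 0 ((n : ℕ) : ℤ)) (torusLift N U))
    with hgB
  have hfC : ∀ U, |fA U| ≤ CA := fun U => hCA _
  have hgC : ∀ U, |gB U| ≤ CB := fun U => hCB _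
  have hf2 : MemLp fA 2 μ := MemLp.of_bound hfm.aestronglyMeasurable CA
    (ae_of_all _ fun U => by rw [Real.norm_eq_abs]; exact hfC U)
  have hg2 : MemLp gB 2 μ := MemLp.of_bound hgm.aestronglyMeasurable CB
    (ae_of_all _ fun U => by rw [Real.norm_eq_abs]; exact hgC U)
  set xA : Lp ℝ 2 μ := hf2.toLp fA with hxA
  set xB : Lp ℝ 2 μ := hg2.toLp gB with hxB
  set one : Lp ℝ 2 μ := Lp.const 2 μ (1 : ℝ) with hone
  set cA : ℝ := ∫ U, fA U ∂μ with hcA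
  set cB : ℝ := ∫ U, gB U ∂μ with hcB
  -- the correlation in `L²` language
  have hsmul_one : ∀ c : ℝ, c • one = Lp.const 2 μ c := fun c => smul_Lp_const_one μ c
  have hone_A : ⟪one, xA⟫_ℝ = cA := by
    rw [hone, inner_const_one_left]; exact integral_congr_ae hf2.coeFn_toLp
  have hone_B : ⟪one, xB⟫_ℝ = cB := by
    rw [hone, inner_const_one_left]; exact integral_congr_ae hg2.coeFn_toLp
  have hone_one : ⟪one, one⟫_ℝ = 1 := inner_Lp_const_one_one μ
  have hcorr : latticeConnectedCorr ρ β N A.F B.F n = ⟪xA, xB⟫_ℝ - cA * cB := by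
    have h1 : ⟪xA, xB⟫_ℝ = ∫ U, fA U * gB U ∂μ := by
      rw [inner_eq_integral_mul]
      refine integral_congr_ae ?_
      filter_upwards [hf2.coeFn_toLp, hg2.coeFn_toLp] with U hU hV
      rw [hU, hV]
    rw [h1, latticeConnectedCorr_eq_integral_sub]
  set P : (Fin 4 → Fin m) → (Lp ℝ 2 μ →L[ℝ] Lp ℝ 2 μ) := fun z =>
    (lpMeas ℝ ℝ (extSigma G N m z) 2 μ).starProjection with hPdef
  have hPone : ∀ z, P z one = one := fun z => starProjection_const μ 1
  have hPsa : ∀ z, IsSelfAdjoint (1 - P z) := fun z =>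
    (IsSelfAdjoint.one _).sub (isSelfAdjoint_starProjection _)
  have hPnorm : ∀ z, ‖P z‖ ≤ 1 := fun z => Submodule.starProjection_norm_le _
  set H : Lp ℝ 2 μ →L[ℝ] Lp ℝ 2 μ := ∑ z : Fin 4 → Fin m, (1 - P z) with hHdef
  have hHsa : IsSelfAdjoint H := isSelfAdjoint_sum _ fun z _ => hPsa z
  have hsum_apply : ∀ (R : Finset (Fin 4 → Fin m)) (x : Lp ℝ 2 μ),
      (∑ z ∈ R, (1 - P z)) x = ∑ z ∈ R, (x - P z x) := fun R x => by
    simp only [sum_apply, sub_apply, one_apply_eq_self]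
  have hHone : H one = 0 := by
    rw [hHdef, hsum_apply]; exact Finset.sum_eq_zero fun z _ => by rw [hPone, sub_self]
  obtain ⟨W, hWcl, hHW, hPW, hmemW⟩ := exists_invariantSector ρ β μ hρ hγ hGP hμ
  have hcontr := hSC (Lp ℝ 2 μ) H W γ hHsa hWcl hHW hPW
  obtain ⟨Msub, hMcl, hMmono, hMA2, hMA3, hMmem⟩ := exists_localSubspaces ρ β μ hρ hμ hm4 hmN
  set adj : (Fin 4 → Fin m) → (Fin 4 → Fin m) → Prop := fun z w => ∀ k, cdist (z k) (w k) ≤ 2 with hadj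
  letI hdec : DecidableRel adj := fun z w =>
    show Decidable (∀ k, cdist (z k) (w k) ≤ 2) from inferInstance
  have hrefl : ∀ z, adj z z := fun z k => by simp [cdist]
  have hcol : ∀ w, (Finset.univ.filter fun z => adj z w).card ≤ 625 := fun w =>
    (congrArg Finset.card (Finset.filter_congr fun z _ => Iff.rfl)).trans_le (card_filter_cdist_le_two hm4 w)
  have hcone := hLC (Lp ℝ 2 μ) (Fin 4 → Fin m) adj 625 P Msub hrefl hcol hPnorm hMmono hMA2
    (fun z R hfar x hx => hMA3 z R hfar x hx)
  set nb : Finset (Fin 4 → Fin m) → Finset (Fin 4 → Fin m) := fun R =>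
    Finset.univ.filter fun z => ∃ w ∈ R, adj z w with hnb
  haveI hIBdec : ∀ (z : Fin 4 → Fin m) (x : Site 4 N), Decidable (InBlock N m z x) := fun z x =>
    Classical.dec _
  set TA : Finset (Edge 4 N) := A.supp.image fun e => torusEdge N (e.1 + Pi.single 0 ((0 : ℕ) : ℤ), e.2)
    with hTA
  set TB : Finset (Edge 4 N) := B.supp.image fun e => torusEdge N (e.1 + Pi.single 0 ((n : ℕ) : ℤ), e.2)
    with hTB
  set R₀A : Finset (Fin 4 → Fin m) := Finset.univ.filter fun z => ∃ e ∈ TA, InBlock N m z e.1 with hR₀A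
  set R₀B : Finset (Fin 4 → Fin m) := Finset.univ.filter fun z => ∃ e ∈ TB, InBlock N m z e.1 with hR₀B
  have hR₀A_mem : ∀ z, z ∈ R₀A ↔ ∃ e ∈ TA, InBlock N m z e.1 := fun z => by simp [hR₀A]
  have hR₀B_mem : ∀ z, z ∈ R₀B ↔ ∃ e ∈ TB, InBlock N m z e.1 := fun z => by simp [hR₀B]
  have hcardA : (R₀A.card : ℝ) ≤ 81 * A.supp.card := by
    have h1 := card_blocks_le hm2 TA R₀A fun z hz => (hR₀A_mem z).1 hz
    have h2 : TA.card ≤ A.supp.card := Finset.card_image_le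
    exact_mod_cast h1.trans (Nat.mul_le_mul_left 81 h2)
  have hcardB : (R₀B.card : ℝ) ≤ 81 * B.supp.card := by
    have h1 := card_blocks_le hm2 TB R₀B fun z hz => (hR₀B_mem z).1 hz
    have h2 : TB.card ≤ B.supp.card := Finset.card_image_le
    exact_mod_cast h1.trans (Nat.mul_le_mul_left 81 h2)
  have hxA_mem : xA ∈ Msub R₀A :=
    hMmem fA hf2 TA R₀A hfm ⟨CA, hfC⟩ hfdep fun z hz => (hR₀A_mem z).2 hz
  have hxB_mem : xB ∈ Msub R₀B :=
    hMmem gB hg2 TB R₀B hgm ⟨CB, hgC⟩ hgdep fun z hz => (hR₀B_mem z).2 hz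
  -- depth
  set Lown : ℕ := min ((n - M) * m / N) (m - (n + M) * m / N) with hLown
  have hL : (n : ℝ) / b - M - 2 ≤ Lown := div_sub_le_min hN hb hmdef hMn hnS
  obtain ⟨D, hD1, hD2⟩ := exists_depth hb hL hn
  set ΛA := nb^[D] R₀A with hΛA
  set ΛB := nb^[D] R₀B with hΛB
  have hsubA : R₀A ⊆ ΛA := subset_iterate_nbhd adj hrefl D R₀A
  have hsubB : R₀B ⊆ ΛB := subset_iterate_nbhd adj hrefl D R₀B
  set φ : (Fin 4 → Fin m) → ℕ := fun z => ((((z 0 : ℕ) : ZMod m)).valMinAbs).natAbs with hφ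
  have hφ_tri : ∀ z w : Fin 4 → Fin m, φ w ≤ φ z + cdist (z 0) (w 0) := fun z w =>
    natAbs_valMinAbs_le_add_sub _ _
  have hcdist_comm : ∀ i j : Fin m, cdist i j = cdist j i := fun i j => natAbs_valMinAbs_sub_comm _ _
  have hφadj : ∀ z w, adj z w → φ z ≤ φ w + 2 := fun z w h => by
    have := hφ_tri w z; have := h 0; rw [hcdist_comm] at this; omega
  have hφadj' : ∀ z w, adj z w → φ w ≤ φ z + 2 := fun z w h => by
    have := hφ_tri z w; have := h 0; omega
  have hφA : ∀ z ∈ R₀A, φ z ≤ M + 2 := fun z hz =>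
    natAbs_valMinAbs_index_le hm0 hmN hMN A.supp hMA ((hR₀A_mem z).1 hz)
  have hφB : ∀ w ∈ R₀B, Lown ≤ φ w + 1 := fun w hw =>
    min_le_natAbs_valMinAbs_index hN hm0 hMn hnS B.supp hMB ((hR₀B_mem w).1 hw)
  have hΛA_le : ∀ z ∈ ΛA, φ z ≤ M + 2 + 2 * D := iterate_nbhd_le adj φ hφadj D R₀A (M + 2) hφA
  have hΛB_ge : ∀ w ∈ ΛB, Lown ≤ (φ w + 1) + 2 * D :=
    iterate_nbhd_ge adj (fun w => φ w + 1) (fun z w h => by have := hφadj' z w h; omega) D R₀B Lown hφB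
  have hGR : ∀ z ∈ ΛA, ∀ w ∈ ΛB, 3 ≤ cdist (z 0) (w 0) := fun z hz w hw => by
    have h1 := hΛA_le z hz; have h2 := hΛB_ge w hw; have h3 := hφ_tri z w; omega
  have hfarAB : ∀ z ∈ ΛA, ∀ w ∈ ΛB, ¬ adj z w := fun z hz w hw h => by
    have := hGR z hz w hw; have := h 0; omega
  have hfarBA : ∀ w ∈ ΛB, ∀ z ∈ ΛA, ¬ adj w z := fun w hw z hz h => by
    have := hGR z hz w hw; have := h 0; rw [hcdist_comm] at this; omega
  set HA : Lp ℝ 2 μ →L[ℝ] Lp ℝ 2 μ := ∑ z ∈ ΛA, (1 - P z) with hHA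
  set HB : Lp ℝ 2 μ →L[ℝ] Lp ℝ 2 μ := ∑ z ∈ ΛB, (1 - P z) with hHB
  set t : ℝ := (D + 1 : ℝ) / (625 * Real.exp 2) with htdef
  have ht : 0 ≤ t := by positivity
  have hsaA : IsSelfAdjoint (NormedSpace.exp (-(t • HA))) :=
    ((IsSelfAdjoint.all t).smul (isSelfAdjoint_sum _ fun z _ => hPsa z)).neg.exp
  have hsaB : IsSelfAdjoint (NormedSpace.exp (-(t • HB))) :=
    ((IsSelfAdjoint.all t).smul (isSelfAdjoint_sum _ fun z _ => hPsa z)).neg.exp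
  have hsymm : ∀ {S : Lp ℝ 2 μ →L[ℝ] Lp ℝ 2 μ}, IsSelfAdjoint S → ∀ x y : Lp ℝ 2 μ,
      ⟪S x, y⟫_ℝ = ⟪x, S y⟫_ℝ := fun hS x y => by
    have h := hS.isSymmetric x y; simpa only [ContinuousLinearMap.coe_coe] using h
  -- kernels
  have hkill : ∀ {S : Lp ℝ 2 μ →L[ℝ] Lp ℝ 2 μ} {x : Lp ℝ 2 μ}, S x = 0 →
      NormedSpace.exp (-(t • S)) x = x := fun {S x} hx =>
    exp_apply_eq_self_of_apply_eq_zero _ (by rw [neg_apply, smul_apply, hx, smul_zero, neg_zero])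
  have hHBxA : HB xA = 0 := by
    rw [hHB, hsum_apply]
    exact Finset.sum_eq_zero fun w hw => by
      rw [hMA3 w R₀A (fun z hz => hfarBA w hw z (hsubA hz)) xA hxA_mem, sub_self]
  have hHAone : HA one = 0 := by
    rw [hHA, hsum_apply]; exact Finset.sum_eq_zero fun z _ => by rw [hPone, sub_self]
  have hHBone : HB one = 0 := by
    rw [hHB, hsum_apply]; exact Finset.sum_eq_zero fun z _ => by rw [hPone, sub_self]
  -- locality of the evolved second observable
  set GB : Lp ℝ 2 μ := NormedSpace.exp (-(t • HB)) xB with hGBdef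
  set FA : Lp ℝ 2 μ := NormedSpace.exp (-(t • HA)) xA with hFAdef
  have hGBmem : GB ∈ Msub ΛB := by
    refine exp_apply_mem_of_forall_apply_mem (-(t • HB)) (Msub ΛB) (hMcl ΛB) (fun y hy => ?_)
      (hMmono _ _ hsubB hxB_mem)
    rw [neg_apply, smul_apply, hHB, hsum_apply]
    refine Submodule.neg_mem _ (Submodule.smul_mem _ _ (Submodule.sum_mem _ fun w hw => ?_))
    refine Submodule.sub_mem _ hy ?_
    have := hMA2 w ΛB y hy
    rwa [Finset.insert_eq_of_mem hw] at this
  have hHAGB : HA GB = 0 := by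
    rw [hHA, hsum_apply]
    exact Finset.sum_eq_zero fun z hz => by
      rw [hMA3 z ΛB (fun w hw => hfarAB z hz w hw) GB hGBmem, sub_self]
  -- the identities
  have hI1 : ⟪xA, xB⟫_ℝ = ⟪FA, GB⟫_ℝ := by
    calc ⟪xA, xB⟫_ℝ = ⟪NormedSpace.exp (-(t • HB)) xA, xB⟫_ℝ := by rw [hkill hHBxA]
      _ = ⟪xA, GB⟫_ℝ := hsymm hsaB _ _
      _ = ⟪xA, NormedSpace.exp (-(t • HA)) GB⟫_ℝ := by rw [hkill hHAGB]
      _ = ⟪FA, GB⟫_ℝ := (hsymm hsaA _ _).symm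
  have hIA : ⟪one, FA⟫_ℝ = cA := by
    rw [hFAdef, ← hsymm hsaA, hkill hHAone, hone_A]
  have hIB : ⟪one, GB⟫_ℝ = cB := by
    rw [hGBdef, ← hsymm hsaB, hkill hHBone, hone_B]
  have hcorr2 : latticeConnectedCorr ρ β N A.F B.F n = ⟪FA - cA • one, GB - cB • one⟫_ℝ := by
    rw [hcorr, hI1, inner_sub_left, inner_sub_right, inner_sub_right, real_inner_smul_left,
      real_inner_smul_left, real_inner_smul_right, real_inner_smul_right, hIB, hone_one,
      real_inner_comm one FA, hIA]
    ring
  obtain ⟨-, hexp_num, hexp_gap, hexp_final⟩ := depth_numerics hγ D M (n := n) (b := b) hD2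
  have hnorm_one : ‖one‖ = 1 := norm_Lp_const_one μ
  have hPt_one : NormedSpace.exp (-(t • H)) one = one := hkill hHone
  have hq0 : 0 ≤ ((((625 : ℕ) : ℝ)) * t) ^ (D + 1) / (D + 1).factorial := by positivity
  have hfactor : ∀ (F : GaugeConfig 4 N G → ℝ) (hF2 : MemLp F 2 μ) (CO : ℝ) (R₀ : Finset (Fin 4 → Fin m)),
      Measurable F → (∀ U, |F U| ≤ CO) → IsGaugeInvariant F → 0 ≤ CO → hF2.toLp F ∈ Msub R₀ →
      ‖NormedSpace.exp (-(t • ∑ z ∈ nb^[D] R₀, (1 - P z))) (hF2.toLp F) - (∫ U, F U ∂μ) • one‖ ≤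
        2 * CO * (R₀.card * (((((625 : ℕ) : ℝ)) * t) ^ (D + 1) / (D + 1).factorial)) +
          Real.exp (-(γ * t)) * (2 * CO) := by
    intro F hF2 CO R₀ hFm hFC hFi hCO0 hmem
    set x := hF2.toLp F with hxdef
    set c := ∫ U, F U ∂μ with hcdef
    have hx_norm : ‖x‖ ≤ CO := norm_le_of_abs_le μ x hCO0 (hF2.coeFn_toLp.mono fun U hU => by
      rw [hU]; exact hFC U)
    have hc_abs : |c| ≤ CO := by
      have := norm_integral_le_of_norm_le_const (μ := μ) (f := F) (C := CO)
        (ae_of_all _ fun U => by rw [Real.norm_eq_abs]; exact hFC U)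
      simpa [Real.norm_eq_abs] using this
    have hxW : x - c • one ∈ W := by
      rw [hsmul_one]; exact hmemW F hFm ⟨CO, hFC⟩ hFi hF2
    -- light cone
    have h1 := hcone R₀ (nb^[D] R₀) D x hmem subset_rfl t ht
    have h1' : ‖NormedSpace.exp (-(t • ∑ z ∈ nb^[D] R₀, (1 - P z))) x - NormedSpace.exp (-(t • H)) x‖ ≤
        2 * CO * (R₀.card * (((((625 : ℕ) : ℝ)) * t) ^ (D + 1) / (D + 1).factorial)) := by
      rw [norm_sub_rev, hHdef]
      refine h1.trans ?_
      have e : 2 * ‖x‖ * (R₀.card : ℝ) * ((((625 : ℕ) : ℝ)) * t) ^ (D + 1) / (D + 1).factorial =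
          2 * ‖x‖ * (R₀.card * (((((625 : ℕ) : ℝ)) * t) ^ (D + 1) / (D + 1).factorial)) := by ring
      rw [e]
      exact mul_le_mul_of_nonneg_right (by linarith only [hx_norm]) (mul_nonneg (Nat.cast_nonneg _) hq0)
    -- contraction
    have h2 : ‖NormedSpace.exp (-(t • H)) x - c • one‖ ≤ Real.exp (-(γ * t)) * (2 * CO) := by
      have e : NormedSpace.exp (-(t • H)) x - c • one = NormedSpace.exp (-(t • H)) (x - c • one) := by
        rw [map_sub, map_smul, hPt_one]
      rw [e]
      refine (hcontr t ht _ hxW).trans (mul_le_mul_of_nonneg_left ?_ (Real.exp_pos _).le)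
      calc ‖x - c • one‖ ≤ ‖x‖ + ‖c • one‖ := norm_sub_le _ _
        _ ≤ CO + CO := by
          rw [norm_smul, hnorm_one, mul_one, Real.norm_eq_abs]; exact add_le_add hx_norm hc_abs
        _ = 2 * CO := by ring
    exact (norm_sub_le_norm_sub_add_norm_sub _ (NormedSpace.exp (-(t • H)) x) _).trans (add_le_add h1' h2)
  have hbound : ∀ {X CO : ℝ} {R₀c s : ℝ}, 0 ≤ CO → 0 ≤ R₀c → X ≤ 2 * CO * (R₀c * (((((625 : ℕ) : ℝ)) * t) ^
      (D + 1) / (D + 1).factorial)) + Real.exp (-(γ * t)) * (2 * CO) → R₀c ≤ 81 * s →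
      X ≤ (2 * CO * (81 * s + 1)) * Real.exp (-ρ₀ * (D + 1)) := by
    intro X CO R₀c s hCO hR0 hX hR
    have h1 : R₀c * (((((625 : ℕ) : ℝ)) * t) ^ (D + 1) / (D + 1).factorial) ≤
        (81 * s) * Real.exp (-ρ₀ * (D + 1)) :=
      mul_le_mul hR hexp_num hq0 (by linarith only [hR0, hR])
    have h2 : Real.exp (-(γ * t)) * (2 * CO) ≤ Real.exp (-ρ₀ * (D + 1)) * (2 * CO) :=
      mul_le_mul_of_nonneg_right hexp_gap (by linarith only [hCO])
    have h3 : 2 * CO * (R₀c * (((((625 : ℕ) : ℝ)) * t) ^ (D + 1) / (D + 1).factorial)) ≤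
        2 * CO * ((81 * s) * Real.exp (-ρ₀ * (D + 1))) := mul_le_mul_of_nonneg_left h1 (by linarith only [hCO])
    have e : (2 * CO * (81 * s + 1)) * Real.exp (-ρ₀ * (D + 1)) =
        2 * CO * ((81 * s) * Real.exp (-ρ₀ * (D + 1))) + Real.exp (-ρ₀ * (D + 1)) * (2 * CO) := by ring
    rw [e]; linarith only [hX, h2, h3]
  have hFA_le : ‖FA - cA • one‖ ≤ (2 * CA * (81 * A.supp.card + 1)) * Real.exp (-ρ₀ * (D + 1)) :=
    hbound hCA0 (Nat.cast_nonneg _) (hfactor fA hf2 CA R₀A hfm hfC hfi hCA0 hxA_mem) hcardA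
  have hGB_le : ‖GB - cB • one‖ ≤ (2 * CB * (81 * B.supp.card + 1)) * Real.exp (-ρ₀ * (D + 1)) :=
    hbound hCB0 (Nat.cast_nonneg _) (hfactor gB hg2 CB R₀B hgm hgC hgi hCB0 hxB_mem) hcardB
  have h81 : ∀ k : ℕ, (0 : ℝ) ≤ 81 * k + 1 := fun k =>
    add_nonneg (mul_nonneg (by norm_num) (Nat.cast_nonneg k)) zero_le_one
  have hcf0 : 0 ≤ 2 * CA * (81 * A.supp.card + 1) :=
    mul_nonneg (mul_nonneg zero_le_two hCA0) (h81 _)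
  have hcg0 : 0 ≤ 2 * CB * (81 * B.supp.card + 1) :=
    mul_nonneg (mul_nonneg zero_le_two hCB0) (h81 _)
  rw [hcorr2]
  calc |⟪FA - cA • one, GB - cB • one⟫_ℝ| ≤ ‖FA - cA • one‖ * ‖GB - cB • one‖ := abs_real_inner_le_norm _ _
    _ ≤ ((2 * CA * (81 * A.supp.card + 1)) * Real.exp (-ρ₀ * (D + 1))) *
        ((2 * CB * (81 * B.supp.card + 1)) * Real.exp (-ρ₀ * (D + 1))) :=
        mul_le_mul hFA_le hGB_le (norm_nonneg _) (mul_nonneg hcf0 (Real.exp_pos _).le)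
    _ = (2 * CA * (81 * A.supp.card + 1)) * (2 * CB * (81 * B.supp.card + 1)) *
        (Real.exp (-ρ₀ * (D + 1)) * Real.exp (-ρ₀ * (D + 1))) := by ring
    _ ≤ (2 * CA * (81 * A.supp.card + 1)) * (2 * CB * (81 * B.supp.card + 1)) *
        (Real.exp (ρ₀ * (M + 4)) * Real.exp (-(ρ₀ / 2 * n / b))) :=
        mul_le_mul_of_nonneg_left hexp_final (mul_nonneg hcf0 hcg0)
    _ = _ := by ring

end MainEstimate

end GapToClustering

open GapToClustering in
/-- **Stub S4 of line `knabe-block-sampler`** (gap ⇒ clustering for the block sampler, in the crux's currency): for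
every global constant `γ > 0` there is a combinatorial rate `ρ > 0` such that for every pair of gauge-invariant local
observables there is `C(A,B)` with `|corr_β(A,B,n)| ≤ C e^{−ρ n/b}` whenever `GlobalPoincare r.ρ β (2S+1) b γ`, `n ≤ S`,
`b ≥ 1` — given the abstract semigroup contraction and light cone. -/
theorem stub_gapToClustering : (∀ (E : Type) [NormedAddCommGroup E] [InnerProductSpace ℝ E] [CompleteSpace E] (H : E →L[ℝ] E) (W : Submodule ℝ E) (γ : ℝ), IsSelfAdjoint H → IsClosed (W : Set E) → (∀ x ∈ W, H x ∈ W) → (∀ x ∈ W, γ * ‖x‖ ^ 2 ≤ ⟪H x, x⟫_ℝ) → ∀ (t : ℝ), 0 ≤ t → ∀ x ∈ W, ‖NormedSpace.exp (-(t • H)) x‖ ≤ Real.exp (-(γ * t)) * ‖x‖) → (∀ (E : Type) [NormedAddCommGroup E] [NormedSpace ℝ E] [CompleteSpace E] (ι : Type) [Fintype ι] [DecidableEq ι] (adj : ι → ι → Prop) [DecidableRel adj] (K : ℕ) (T : ι → E →L[ℝ] E) (M : Finset ι → Submodule ℝ E), (∀ z, adj z z) → (∀ w, (Finset.univ.filter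 fun z => adj z w).card ≤ K) → (∀ z, ‖T z‖ ≤ 1) → (∀ R R' : Finset ι, R ⊆ R' → M R ≤ M R') → (∀ (z : ι) (R : Finset ι), ∀ x ∈ M R, T z x ∈ M (insert z R)) → (∀ (z : ι) (R : Finset ι), (∀ w ∈ R, ¬ adj z w) → ∀ x ∈ M R, T z x = x) → ∀ (R₀ Λ : Finset ι) (D : ℕ) (f : E), f ∈ M R₀ → (fun R : Finset ι => Finset.univ.filter fun z => ∃ w ∈ R, adj z w)^[D] R₀ ⊆ Λ → ∀ t : ℝ, 0 ≤ t → ‖NormedSpace.exp (-(t • ∑ z : ι, (1 - T z))) f - NormedSpace.exp (-(t • ∑ z ∈ Λ, (1 - T z))) f‖ ≤ 2 * ‖f‖ * R₀.card * (K * t) ^ (D + 1) / (D + 1).factorial) → ∀ (G : Type) [Group G] [TopologicalSpace G] [IsTopologicalGroup G] [CompactSpace G] [MeasurableSpace G] [BorelSpace G] (r : LatticeRep G) (γ : ℝ), 0 < γ → ∃ ρ : ℝ, 0 < ρ ∧ ∀ A B : YMSpecies G, ∃ C : ℝ, ∀ (β : ℝ) (b S n : ℕ), 1 ≤ b → n ≤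 S → GlobalPoincare r.ρ β (2 * S + 1) b γ → |latticeConnectedCorr r.ρ β (2 * S + 1) A.F B.F n| ≤ C * Real.exp (-(ρ * n / b)) := by
  intro hSC hLC G _ _ _ _ _ _ r γ hγ
  haveI : SecondCountableTopology G :=
    (r.continuous.isClosedEmbedding r.injective).isEmbedding.secondCountableTopology
  haveI : T2Space G := (r.continuous.isClosedEmbedding r.injective).isEmbedding.t2Space
  set ρ₀ : ℝ := min 1 (γ / (625 * Real.exp 2)) with hρ₀
  have hρ₀pos : 0 < ρ₀ := lt_min one_pos (by positivity)
  refine ⟨ρ₀ / 2, by positivity, fun A B => ?_⟩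
  obtain ⟨CA, hCA⟩ := A.bounded
  obtain ⟨CB, hCB⟩ := B.bounded
  have hCA0 : 0 ≤ CA := (abs_nonneg _).trans (hCA fun _ => 1)
  have hCB0 : 0 ≤ CB := (abs_nonneg _).trans (hCB fun _ => 1)
  set M : ℕ := (A.supp ∪ B.supp).sup fun e => (e.1 0).natAbs with hM
  have hMA : ∀ e ∈ A.supp, (e.1 0).natAbs ≤ M := fun e he =>
    Finset.le_sup (f := fun e : Literature.MathematicalPhysics.QuantumLattice.ZdEdge 4 => (e.1 0).natAbs)
      (Finset.mem_union_left _ he)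
  have hMB : ∀ e ∈ B.supp, (e.1 0).natAbs ≤ M := fun e he =>
    Finset.le_sup (f := fun e : Literature.MathematicalPhysics.QuantumLattice.ZdEdge 4 => (e.1 0).natAbs)
      (Finset.mem_union_right _ he)
  have h81 : ∀ k : ℕ, (0 : ℝ) ≤ 81 * k + 1 := fun k =>
    add_nonneg (mul_nonneg (by norm_num) (Nat.cast_nonneg k)) zero_le_one
  set C₁ : ℝ := (2 * CA * (81 * A.supp.card + 1)) * (2 * CB * (81 * B.supp.card + 1)) *
    Real.exp (ρ₀ * (M + 4)) with hC₁
  set C₂ : ℝ := 2 * (CA * CB) * Real.exp (ρ₀ / 2 * (2 * M + 11)) with hC₂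
  have hC₁0 : 0 ≤ C₁ := mul_nonneg (mul_nonneg (mul_nonneg (mul_nonneg zero_le_two hCA0) (h81 _))
    (mul_nonneg (mul_nonneg zero_le_two hCB0) (h81 _))) (Real.exp_pos _).le
  have hC₂0 : 0 ≤ C₂ := mul_nonneg (mul_nonneg zero_le_two (mul_nonneg hCA0 hCB0)) (Real.exp_pos _).le
  refine ⟨C₁ + C₂, fun β b S n hb hnS hGP => ?_⟩
  have hb' : (0 : ℝ) < b := by exact_mod_cast hb
  by_cases hn : b * (2 * M + 11) ≤ n
  · have h := abs_latticeConnectedCorr_le_of_globalPoincare hSC hLC r.ρ r.continuous hγ A B hCA hCB M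
      hMA hMB β (N := 2 * S + 1) rfl hb hnS hn hGP
    calc |latticeConnectedCorr r.ρ β (2 * S + 1) A.F B.F n| ≤ C₁ * Real.exp (-(ρ₀ / 2 * n / b)) := h
      _ ≤ (C₁ + C₂) * Real.exp (-(ρ₀ / 2 * n / b)) :=
        mul_le_mul_of_nonneg_right (le_add_of_nonneg_right hC₂0) (Real.exp_pos _).le
  · have hlt : (n : ℝ) / b < 2 * M + 11 := by
      rw [div_lt_iff₀ hb']
      have : n < b * (2 * M + 11) := Nat.lt_of_not_le hn
      have : (n : ℝ) < ((b * (2 * M + 11) : ℕ) : ℝ) := by exact_mod_cast this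
      push_cast at this; linarith
    have hexp : (1 : ℝ) ≤ Real.exp (ρ₀ / 2 * (2 * M + 11)) * Real.exp (-(ρ₀ / 2 * n / b)) := by
      rw [← Real.exp_add, Real.one_le_exp_iff]
      have h1 : ρ₀ / 2 * (n : ℝ) / b = (ρ₀ / 2) * ((n : ℝ) / b) := by ring
      rw [h1]
      nlinarith only [hlt, hρ₀pos]
    have hap := abs_latticeConnectedCorr_le_two_mul r β (2 * S + 1) (A := A.F) (B := B.F) hCA hCB n
    have h2 : 0 ≤ 2 * (CA * CB) := mul_nonneg zero_le_two (mul_nonneg hCA0 hCB0)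
    calc |latticeConnectedCorr r.ρ β (2 * S + 1) A.F B.F n| ≤ 2 * (CA * CB) * 1 := by rw [mul_one]; exact hap
      _ ≤ 2 * (CA * CB) * (Real.exp (ρ₀ / 2 * (2 * M + 11)) * Real.exp (-(ρ₀ / 2 * n / b))) :=
        mul_le_mul_of_nonneg_left hexp h2
      _ = C₂ * Real.exp (-(ρ₀ / 2 * n / b)) := by rw [hC₂]; ring
      _ ≤ (C₁ + C₂) * Real.exp (-(ρ₀ / 2 * n / b)) :=
        mul_le_mul_of_nonneg_right (le_add_of_nonneg_left hC₁0) (Real.exp_pos _).le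


end Summit.QuantumFields.YangMills.Theorems.LatticeGapInUVUnits.KnabeBlockSampler

end
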